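import Literature.AlgebraicGeometry.Resolution.ProjHomogeneousIdealSheafReduced
import Literature.AlgebraicGeometry.Resolution.MarkedIdealsLemmas
import Summits.ResolutionOfSingularities.ResolutionOfSingularities.Theorems.EquisingularLiftEquisingularLiftProjectiveAmbientSmoothProper
import HarnessLib

/-!
# [OURS · L1 W4.5(b) · EL♮(3)] T-LIFT-CI, part 3 (PROJ PACKAGING): the ideal sheaf `C = (F̃₁,…,F̃_c)~` of homogeneous forms on
# `ℙⁿ_O` — stalk generators on the standard charts and BASE CHANGE along `ℙⁿ_k → ℙⁿ_O`

Cell `res-hironaka`, rung L, slot W4.5(b); crux **EL♮(3)** (stmt-ResolutionOfSingularities-20148), registered stub `stub_elnat_ciNoseThenPoints`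
(res-L1-w45b-lead-2 RESHAPE v6, 2026-08-27T08:54:27Z); CUT (L1) T-LIFT-CI of res-D-pv-027 AS res-L1-s36-pv-4. OURS; NOT a statement of any manuscript;
AI-written, weaker than expert review. No definition, no `sorry`, standard axioms. `--supports stmt-ResolutionOfSingularities-20148 --as helper`.

The nose of the «smooth complete-intersection nose» cut is the closed subscheme of `ℙⁿ_O = Proj O[x₀..xₙ]` cut out by homogeneous lifts
`F̃ᵢ` of the downstairs forms `fᵢ`. It is carried DEF-FREE as the tree's `projIdealSheaf 𝒜 ⟨(F̃), _⟩` (`Literature/…/ProjHomogeneousIdealSheaf`: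
the kernel ideal sheaf of `Proj(O[x] ↠ O[x]/(F̃))`). This file records the two bookkeeping facts the centre criterion (part 2) and the rung need:

* `stalkIdeal_projIdealSheaf_span` — at a point `y ∈ D₊(x_i)`, the STALK `C_y` is generated by the germs of the dehomogenised forms
  `F̃_l / x_i^{d_l}` (tree `projIdealSheaf_ideal_basicOpen_span` + `stalkIdeal_eq_map_germ`);
* `comap_projIdealSheaf_span` — **BASE CHANGE**: along `g = Proj φ : ℙⁿ_k → ℙⁿ_O` (`φ` a graded ring map with `φ(x_i) = x_i`, e.g. the
  coefficient map of `π : O → k`), `(F̃)~ · 𝒪_{ℙⁿ_k} = (φ F̃)~` — chartwise, `g^*(F̃_l/x_iᵈ) = φ(F̃_l)/x_iᵈ` (Mathlib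
  `Proj.awayToSection_comp_appLE`, `Away.map_mk`; pattern of `…NatLinearCentreKill.ker_projMap_kill_eq_comap`).

References: R. Hartshorne, *Algebraic Geometry* (1977), II Prop. 5.9, Ex. 3.12 [Hartshorne1977]; cell: TARGET-CINOSE (lead-2).
-/

set_option linter.dupNamespace false -- mandated namespace `Summit.<Summit>.<Problem>` of this single-conjunct summit

noncomputable section

open CategoryTheory AlgebraicGeometry TopologicalSpace IsLocalRing
open MvPolynomial HomogeneousLocalization
open Literature.AlgebraicGeometry.Resolution

attribute [local instance] MvPolynomial.gradedAlgebra

namespace Summit.ResolutionOfSingularities.ResolutionOfSingularities.Cruxes.EquisingularLiftNat.Sections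

namespace CILift

section Stalks

variable {R : Type} [CommRing R] {n c : ℕ} (F : Fin c → MvPolynomial (Fin (n + 1)) R) (d : Fin c → ℕ)
  (hF : ∀ l, F l ∈ homogeneousSubmodule (Fin (n + 1)) R (d l))

/-- The variables are homogeneous of degree one. [folklore] -/
theorem X_mem_one' (i : Fin (n + 1)) : (X i : MvPolynomial (Fin (n + 1)) R) ∈ homogeneousSubmodule (Fin (n + 1)) R 1 :=
  isHomogeneous_X R i

/-- **Stalk generators of `(F̃)~` on the chart `D₊(x_i)`**: at `y ∈ D₊(x_i)`, the stalk `C_y` of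
`C = projIdealSheaf 𝒜 ⟨(F̃₁,…,F̃_c), _⟩` is the ideal of `𝒪_{ℙⁿ,y}` spanned by the germs of the sections `F̃_l / x_i^{d_l}`.
[cite: Hartshorne1977, II Prop. 5.9 (proof)] -/
theorem stalkIdeal_projIdealSheaf_span (i : Fin (n + 1)) (y : Proj (homogeneousSubmodule (Fin (n + 1)) R))
    (hy : y ∈ Proj.basicOpen (homogeneousSubmodule (Fin (n + 1)) R) (X i)) :
    stalkIdeal (projIdealSheaf (homogeneousSubmodule (Fin (n + 1)) R)
        ⟨Ideal.span (Set.range F), isHomogeneous_span_of_forall_mem _ F d hF⟩) y =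
      Ideal.span (Set.range fun l =>
        ((Proj (homogeneousSubmodule (Fin (n + 1)) R)).presheaf.germ
            (Proj.basicOpen (homogeneousSubmodule (Fin (n + 1)) R) (X i)) y hy).hom
          ((Proj.awayToSection (homogeneousSubmodule (Fin (n + 1)) R) (X i)).hom
            (mk₁ (homogeneousSubmodule (Fin (n + 1)) R) (X_mem_one' i) (d l) (F l) (hF l)))) := by
  rw [stalkIdeal_eq_map_germ _ ⟨Proj.basicOpen (homogeneousSubmodule (Fin (n + 1)) R) (X i),
      Proj.isAffineOpen_basicOpen _ (X i) (X_mem_one' i) one_pos⟩ hy]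
  change ((projIdealSheaf (homogeneousSubmodule (Fin (n + 1)) R) _).ideal
      ⟨Proj.basicOpen (homogeneousSubmodule (Fin (n + 1)) R) (X i), _⟩).map _ = _
  rw [projIdealSheaf_ideal_basicOpen_span _ F d hF _ (X_mem_one' i), Ideal.map_span, ← Set.range_comp]
  rfl

end Stalks

/-! ## Base change along `ℙⁿ_k → ℙⁿ_O` -/

section Comap

variable {O k : Type} [CommRing O] [CommRing k] {n c : ℕ}
  (φ : (homogeneousSubmodule (Fin (n + 1)) O) →+*ᵍ (homogeneousSubmodule (Fin (n + 1)) k))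
  (hφ' : HomogeneousIdeal.irrelevant (homogeneousSubmodule (Fin (n + 1)) k) ≤
    (HomogeneousIdeal.irrelevant (homogeneousSubmodule (Fin (n + 1)) O)).map φ)
  (hφX : ∀ i : Fin (n + 1), φ (X i) = X i)
  (F : Fin c → MvPolynomial (Fin (n + 1)) O) (f : Fin c → MvPolynomial (Fin (n + 1)) k) (d : Fin c → ℕ)
  (hF : ∀ l, F l ∈ homogeneousSubmodule (Fin (n + 1)) O (d l)) (hf : ∀ l, f l ∈ homogeneousSubmodule (Fin (n + 1)) k (d l))
  (hφF : ∀ l, φ (F l) = f l)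

include hφX hφF in
/-- **BASE CHANGE of the complete-intersection ideal sheaf**: `(F̃)~ · 𝒪_{ℙⁿ_k} = (f)~` for `f = φ(F̃)` along `Proj φ : ℙⁿ_k → ℙⁿ_O`
(`φ(x_i) = x_i`). Chartwise on `D₊(x_i)`: both sides are spanned by the sections `f_l / x_i^{d_l}`.
[cite: Hartshorne1977, II Prop. 5.9 and Ex. 3.12 (a)] -/
theorem comap_projIdealSheaf_span :
    (projIdealSheaf (homogeneousSubmodule (Fin (n + 1)) O)
        ⟨Ideal.span (Set.range F), isHomogeneous_span_of_forall_mem _ F d hF⟩).comap (Proj.map φ hφ') =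
      projIdealSheaf (homogeneousSubmodule (Fin (n + 1)) k)
        ⟨Ideal.span (Set.range f), isHomogeneous_span_of_forall_mem _ f d hf⟩ := by
  classical
  have hXO : ∀ i : Fin (n + 1), (X i : MvPolynomial (Fin (n + 1)) O) ∈ (homogeneousSubmodule (Fin (n + 1)) O) 1 :=
    fun i => isHomogeneous_X O i
  have hXk : ∀ i : Fin (n + 1), φ (X i) ∈ (homogeneousSubmodule (Fin (n + 1)) k) 1 := fun i => φ.map_mem (hXO i)
  let U : Fin (n + 1) → (Proj (homogeneousSubmodule (Fin (n + 1)) k)).affineOpens := fun i =>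
    ⟨Proj.basicOpen (homogeneousSubmodule (Fin (n + 1)) k) (φ (X i)),
      Proj.isAffineOpen_basicOpen (homogeneousSubmodule (Fin (n + 1)) k) (φ (X i)) (hXk i) one_pos⟩
  have hU : ⨆ i, (U i : (Proj (homogeneousSubmodule (Fin (n + 1)) k)).Opens) = ⊤ := by
    have h := Proj.iSup_basicOpen_eq_top (homogeneousSubmodule (Fin (n + 1)) k)
      (fun i : Fin (n + 1) => (X i : MvPolynomial (Fin (n + 1)) k)) (Summit.ResolutionOfSingularities.ResolutionOfSingularities.Cruxes.EquisingularLift.StrataSplit.irrelevant_le_span n k)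
    have hfun : (fun i => (U i : (Proj (homogeneousSubmodule (Fin (n + 1)) k)).Opens)) =
        fun i => Proj.basicOpen (homogeneousSubmodule (Fin (n + 1)) k) (X i) := by
      funext i
      change Proj.basicOpen (homogeneousSubmodule (Fin (n + 1)) k) (φ (X i)) =
        Proj.basicOpen (homogeneousSubmodule (Fin (n + 1)) k) (X i)
      rw [hφX]
    change iSup (fun i => (U i : (Proj (homogeneousSubmodule (Fin (n + 1)) k)).Opens)) = ⊤
    rw [hfun]
    exact h
  refine Scheme.IdealSheafData.ext_of_iSup_eq_top U hU fun i => ?_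
  let UO : (Proj (homogeneousSubmodule (Fin (n + 1)) O)).affineOpens :=
    ⟨Proj.basicOpen (homogeneousSubmodule (Fin (n + 1)) O) (X i),
      Proj.isAffineOpen_basicOpen (homogeneousSubmodule (Fin (n + 1)) O) (X i) (hXO i) one_pos⟩
  have hle : (U i : (Proj (homogeneousSubmodule (Fin (n + 1)) k)).Opens) ≤
      Proj.map φ hφ' ⁻¹ᵁ (UO : (Proj (homogeneousSubmodule (Fin (n + 1)) O)).Opens) := by
    change Proj.basicOpen (homogeneousSubmodule (Fin (n + 1)) k) (φ (X i)) ≤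
      Proj.map φ hφ' ⁻¹ᵁ Proj.basicOpen (homogeneousSubmodule (Fin (n + 1)) O) (X i)
    rw [Proj.map_preimage_basicOpen]
  rw [ideal_comap_of_le (Proj.map φ hφ') _ UO (U i) hle]
  change ((projIdealSheaf (homogeneousSubmodule (Fin (n + 1)) O) _).ideal
      ⟨Proj.basicOpen (homogeneousSubmodule (Fin (n + 1)) O) (X i), _⟩).map _ =
    (projIdealSheaf (homogeneousSubmodule (Fin (n + 1)) k) _).ideal
      ⟨Proj.basicOpen (homogeneousSubmodule (Fin (n + 1)) k) (φ (X i)), _⟩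
  rw [projIdealSheaf_ideal_basicOpen_span _ F d hF _ (hXO i), projIdealSheaf_ideal_basicOpen_span _ f d hf _ (hXk i),
    Ideal.map_span, ← Set.range_comp]
  -- `g^*(F̃_l / x_iᵈ) = f_l / φ(x_i)ᵈ`, generator by generator
  have hgen : ∀ l : Fin c,
      ((Proj.map φ hφ').appLE (UO : (Proj (homogeneousSubmodule (Fin (n + 1)) O)).Opens)
          (U i : (Proj (homogeneousSubmodule (Fin (n + 1)) k)).Opens) hle).hom
        ((Proj.awayToSection (homogeneousSubmodule (Fin (n + 1)) O) (X i)).hom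
          (mk₁ (homogeneousSubmodule (Fin (n + 1)) O) (hXO i) (d l) (F l) (hF l))) =
      (Proj.awayToSection (homogeneousSubmodule (Fin (n + 1)) k) (φ (X i))).hom
        (mk₁ (homogeneousSubmodule (Fin (n + 1)) k) (hXk i) (d l) (f l) (hf l)) := by
    intro l
    have h := congrArg (fun ψ => ψ.hom (mk₁ (homogeneousSubmodule (Fin (n + 1)) O) (hXO i) (d l) (F l) (hF l)))
      (Proj.awayToSection_comp_appLE φ hφ' (hXO i))
    simp only [CommRingCat.hom_comp, RingHom.comp_apply, CommRingCat.hom_ofHom] at h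
    rw [h]
    congr 1
    apply val_injective
    rw [mk₁, Away.map_mk, val_mk₁, Away.val_mk]
    congr 1
    exact hφF l
  have hfun : ((fun s => ((Proj.map φ hφ').appLE (UO : (Proj (homogeneousSubmodule (Fin (n + 1)) O)).Opens)
        (U i : (Proj (homogeneousSubmodule (Fin (n + 1)) k)).Opens) hle).hom s) ∘ fun l : Fin c =>
        (Proj.awayToSection (homogeneousSubmodule (Fin (n + 1)) O) (X i)).hom
          (mk₁ (homogeneousSubmodule (Fin (n + 1)) O) (hXO i) (d l) (F l) (hF l))) =
      fun l : Fin c => (Proj.awayToSection (homogeneousSubmodule (Fin (n + 1)) k) (φ (X i))).hom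
        (mk₁ (homogeneousSubmodule (Fin (n + 1)) k) (hXk i) (d l) (f l) (hf l)) := by
    funext l
    exact hgen l
  exact congrArg Ideal.span (congrArg Set.range hfun)

end Comap

end CILift

end Summit.ResolutionOfSingularities.ResolutionOfSingularities.Cruxes.EquisingularLiftNat.Sections

end
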